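import Mathlib.Analysis.SpecialFunctions.Complex.Log
import Mathlib.Algebra.Field.GeomSum

/-!
# The symmetry half of the selection rule: a `C_m`-average kills every spin not divisible by `m`

Helper file for the crux `QuadrupoleSelectionRule` (stmt-CriticalPhenomena-7029, informal) of route
`CardyFlipRusso` (sub-problem `CardyFormulaZ2`), line `Sketch`.

The route's rationale ("a law with rotation symmetry of order `m ≥ 3` cannot carry a traceless
rank-2 tensor, so the quadrupole averages to zero; order `2` can") and card A's lever ("every
far-field channel of spin `∉ mℤ` cancels identically under the `C_m`-average") rest on the
discrete orthogonality of characters of the cyclic group: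

* `sum_exp_spin_rotate_eq_zero` — for an integer spin `s` NOT divisible by `m`, the average of the
  phase `e^{i s φ}` over the `m` rotations `φ ↦ φ + 2πj/m` vanishes;
* `quadrupole_cyclic_average_eq_zero` — in particular the spin-2 (quadrupole / stress-tensor)
  phase averages to zero under every rotation symmetry of order `m ≥ 3`;
* `quadrupole_halfTurn_average_ne_zero` — whereas for order `m = 2` (the half-turn symmetry of a
  sheared or anisotropically jittered lattice) it does not: the control prediction of the crux
  (Beffara's embedding-modulus drift, barrier `EmbeddingModulusUniqueness`).
-/

noncomputable section

open Complex Finset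

namespace Summit.CriticalPhenomena.CardyFormulaZ2.Theorems

/-- The `m`-th root of unity `e^{2πi s/m}` attached to an integer spin `s` equals `1` only if
`m ∣ s` (for `m ≠ 0`). [folklore] -/
theorem exp_two_pi_mul_spin_div_ne_one {m : ℕ} {s : ℤ} (hm : m ≠ 0) (hs : ¬ (m : ℤ) ∣ s) :
    Complex.exp (2 * Real.pi * I * s / m) ≠ 1 := by
  intro h
  obtain ⟨n, hn⟩ := Complex.exp_eq_one_iff.1 h
  have hm' : (m : ℂ) ≠ 0 := Nat.cast_ne_zero.2 hm
  have hπ : (2 * Real.pi * I : ℂ) ≠ 0 := by simp [Real.pi_ne_zero, Complex.I_ne_zero]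
  have hmul : 2 * Real.pi * I * s = n * (2 * Real.pi * I) * m := (div_eq_iff hm').1 hn
  have h2 : (s : ℂ) = n * m := by
    apply mul_left_cancel₀ hπ
    linear_combination hmul
  have h3 : ((s : ℤ) : ℂ) = ((m * n : ℤ) : ℂ) := by push_cast; rw [h2]; ring
  exact hs ⟨n, by exact_mod_cast h3⟩

/-- **Discrete orthogonality of cyclic characters.** For an integer spin `s` not divisible by `m`,
the sum of the phases `e^{i s (φ + 2πj/m)}` over the `m` rotations by multiples of `2π/m`
vanishes: a `C_m`-symmetric average carries no Fourier mode of spin `∉ mℤ`. [folklore] -/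
theorem sum_exp_spin_rotate_eq_zero (m : ℕ) (s : ℤ) (hs : ¬ (m : ℤ) ∣ s) (φ : ℝ) :
    ∑ j : Fin m, Complex.exp (s * (φ + 2 * Real.pi * j / m) * I) = 0 := by
  rcases Nat.eq_zero_or_pos m with rfl | hmpos
  · simp
  have hm : m ≠ 0 := Nat.pos_iff_ne_zero.1 hmpos
  set ζ : ℂ := Complex.exp (2 * Real.pi * I * s / m) with hζ
  have hterm : ∀ j : Fin m,
      Complex.exp (s * (φ + 2 * Real.pi * j / m) * I) = Complex.exp (s * φ * I) * ζ ^ (j : ℕ) := by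
    intro j
    rw [hζ, ← Complex.exp_nat_mul, ← Complex.exp_add]
    congr 1
    have hm' : (m : ℂ) ≠ 0 := Nat.cast_ne_zero.2 hm
    field_simp
  rw [Finset.sum_congr rfl fun j _ => hterm j, ← Finset.mul_sum, Fin.sum_univ_eq_sum_range,
    geom_sum_eq (exp_two_pi_mul_spin_div_ne_one hm hs)]
  have hζm : ζ ^ m = 1 := by
    rw [hζ, ← Complex.exp_nat_mul, Complex.exp_eq_one_iff]
    refine ⟨s, ?_⟩
    have hm' : (m : ℂ) ≠ 0 := Nat.cast_ne_zero.2 hm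
    field_simp
  rw [hζm, sub_self, zero_div, mul_zero]

/-- **The quadrupole averages to zero under a rotation symmetry of order `m ≥ 3`.** The spin-2
phase `e^{2i(φ + 2πj/m)}` of the stress-tensor / embedding-modulus channel summed over the `m`
rotations of a `C_m`-invariant law vanishes as soon as `m ≥ 3` (because then `m ∤ 2`). This is the
symmetry half of the selection rule of the crux `QuadrupoleSelectionRule`. [folklore] -/
theorem quadrupole_cyclic_average_eq_zero {m : ℕ} (hm : 3 ≤ m) (φ : ℝ) :
    ∑ j : Fin m, Complex.exp (2 * (φ + 2 * Real.pi * j / m) * I) = 0 := by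
  have h := sum_exp_spin_rotate_eq_zero m 2 (fun ⟨k, hk⟩ => by
    have h1 : (m : ℤ) ≤ 2 := Int.le_of_dvd (by norm_num) ⟨k, hk⟩
    omega) φ
  simpa using h

/-- **Control prediction (order 2 does not suffice).** Under a mere half-turn symmetry the spin-2
phase does NOT average out: `∑_{j<2} e^{2i(φ + πj)} = 2 e^{2iφ} ≠ 0` — sheared / anisotropically
jittered lattices keep a quadrupole (Beffara's embedding-modulus drift). [folklore] -/
theorem quadrupole_halfTurn_average_ne_zero (φ : ℝ) :
    ∑ j : Fin 2, Complex.exp (2 * (φ + 2 * Real.pi * j / 2) * I) ≠ 0 := by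
  rw [Fin.sum_univ_two]
  have h1 : Complex.exp (2 * (φ + 2 * Real.pi * ((1 : Fin 2) : ℕ) / 2) * I)
      = Complex.exp (2 * φ * I) := by
    have : (2 * (φ + 2 * Real.pi * ((1 : Fin 2) : ℕ) / 2) * I : ℂ)
        = 2 * φ * I + (1 : ℤ) * (2 * Real.pi * I) := by
      simp only [Fin.val_one, Nat.cast_one, Int.cast_one]; ring
    rw [this, Complex.exp_add, Complex.exp_int_mul_two_pi_mul_I, mul_one]
  have h0 : Complex.exp (2 * (φ + 2 * Real.pi * ((0 : Fin 2) : ℕ) / 2) * I)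
      = Complex.exp (2 * φ * I) := by
    congr 1; simp only [Fin.val_zero, Nat.cast_zero]; ring
  rw [h0, h1, ← two_mul]
  exact mul_ne_zero two_ne_zero (Complex.exp_ne_zero _)

end Summit.CriticalPhenomena.CardyFormulaZ2.Theorems

end
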